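import Summits.QuantumFields.GaugeBoot.PeriodicWordDerivative
import Summits.QuantumFields.GaugeBoot.PlaquetteInsertion
import HarnessLib

/-!
# The derivative of the Wilson action along the one-link shift = plaquette insertions, periodic lattice (gauge-boot, periodic loop equations 3/5)

HONEST FRAMING (cell `pub-gaugeboot`, page 1 of every file): the venture produces certified bounds
on lattice expectations at stated coupling, gauge group, dimension and torus size; NOT a mass gap,
NOT a continuum limit, NOT a string tension; NOT Yang–Mills-summit-bearing (barriers
`FixedCouplingUltralocality`, `PerturbativeInvisibility`).

File 3/5 of the re-typing of the tree's loop-equation stack over the periodic lattice `(A, e)` of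
`TiltedLatticeGauge.lean`; the verbatim analogue of `PlaquetteInsertion.lean` (whose generic pieces —
the re-oriented plaquette words `plaqWord`, the trace-cyclicity helpers `trace_cyc₀…₃`, the
`Σ_i Σ_j` bookkeeping `sum_sum_ite_lt_eq_left/right`, `re_trace_skew_mul` — are reused). For the
Wilson action `wilsonAction ρ e U = Σ_{p : Plaq A d} (N − Re tr ρ(U_p))` of the periodic lattice:

* `actionDeriv ρ e l X U := −Σ_p Re tr(insDeriv_p)` is the flow derivative of the action along
  `U ↦ U[l ↦ k(t)U_l]`, `ρ(k t) = exp(tX)` (`hasDerivAt_wilsonAction`, `continuous_actionDeriv`);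
* RE-INDEXING of the plaquette sum (valid on EVERY periodic lattice, no injectivity of `x ↦ x + e μ`
  needed beyond the group law): exactly the plaquettes through `l = (x, μ)` contribute, each once per
  slot, re-oriented to start with `l` (`sum_trace_insDeriv_plaq`);
* for skew-Hermitian `X` and unitary `ρ` the symmetric, `ℂ`-linear-in-`X` form
  `actionDeriv = −½·plaqIns`, `plaqIns = Σ_{ν≠μ} Σ_{ε=±} tr(X·(ρ(hol P̃_{ν,ε}) − ρ(hol P̃_{ν,ε}⁻¹)))`
  (`actionDeriv_eq_plaqIns`).

Everything is `[folklore]` (finite sums, trace cyclicity); no measure theory here.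

References: V. Kazakov, Z. Zheng, arXiv:2404.16925 §2.3 (the plaquette terms `A_var` of the loop equation);
S. Cao, M. Park, S. Sheffield, Comm. AMS 5 (2025), Thm. 5.7 (`U(N)`) / Thm. 6.104 (`SU(N)`) (arXiv:2307.06790 numbering; informally Thm. 1.14).
-/

noncomputable section

open MeasureTheory Filter Topology NormedSpace
open scoped Matrix.Norms.Frobenius Matrix
open Summit.QuantumFields.YangMills.Cruxes.CurvatureAmnesia.WardDefect.SchwingerDyson (hasDerivAt_reTrace)

namespace Summit.QuantumFields.GaugeBoot

namespace TiltedRP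

variable {A : Type*} [AddCommGroup A] {d N : ℕ} {G : Type} [Group G]
  {ρ : G →* Matrix (Fin N) (Fin N) ℂ} (e : Fin d → A) (l : Link A d) {X : Matrix (Fin N) (Fin N) ℂ}
  {k : ℝ → G}

/-! ### Closed plaquette words -/

/-- The re-oriented plaquette words are closed on every periodic lattice. [folklore] -/
@[simp] theorem endpoint_plaqWord (x : A) (μ ν : Fin d) (ε : Bool) :
    Word.endpoint e x (plaqWord μ ν ε) = x := by
  cases ε <;> simp [plaqWord, Step.move] <;> abel

/-- Site bookkeeping: `(y + e_i + e_j) − e_i = y + e_j`. [folklore] -/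
theorem add_add_sub_left (y : A) (i j : Fin d) : y + e i + e j - e i = y + e j := by abel

/-! ### The derivative of the Wilson action along the shift -/

section ActionDeriv

variable [DecidableEq A] (ρ X)

/-- The flow derivative of the Wilson action `S = Σ_p (N − Re tr ρ(U_p))` of the periodic lattice along
the one-link shift at `l` in direction `X`: minus the real part of the insertion derivatives of all
plaquette words. [folklore] -/
def actionDeriv [Fintype A] (U : Config A d G) : ℝ :=
  -∑ p : Plaq A d, ((insDeriv ρ e l X U p.1 (Word.plaquette p.2.1.1 p.2.1.2)).trace).re

variable {ρ X}

/-- **The Wilson action is differentiable along the one-link shift with derivative `actionDeriv`.**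
[folklore] -/
theorem hasDerivAt_wilsonAction [Fintype A] (hk : ∀ s t, k (s + t) = k s * k t)
    (hX : ∀ t, ρ (k t) = exp ((t : ℂ) • X)) (U : Config A d G) :
    HasDerivAt (fun t : ℝ => wilsonAction ρ e (Function.update U l (k t * U l)))
      (actionDeriv ρ e l X U) 0 := by
  unfold wilsonAction actionDeriv
  rw [← Finset.sum_neg_distrib]
  refine HasDerivAt.fun_sum fun p _ => ?_
  have h := (hasDerivAt_reTrace (hasDerivAt_wordHolonomy e l hk hX U p.1
    (Word.plaquette p.2.1.1 p.2.1.2))).const_sub (N : ℝ)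
  simpa only [wordHolonomy_plaquette, plaqObs] using h

/-- `actionDeriv` is continuous in the configuration (for continuous `ρ`). [folklore] -/
theorem continuous_actionDeriv [Fintype A] [TopologicalSpace G] [IsTopologicalGroup G]
    (hρ : Continuous ρ) : Continuous fun U : Config A d G => actionDeriv ρ e l X U := by
  unfold actionDeriv
  refine (continuous_finsetSum _ fun p _ => ?_).neg
  exact Complex.continuous_re.comp ((continuous_insDeriv e l hρ p.1 _).matrix_trace)

/-- **Insertion derivative of one plaquette word, term by term** (the four slots of `+i +j −i −j`
at `y`), each term brought to the form `±tr(X·ρ(hol))` of a closed 4-letter word by cyclicity of the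
trace. [folklore] -/
theorem trace_insDeriv_plaquette (U : Config A d G) (y : A) (i j : Fin d) :
    (insDeriv ρ e l X U y (Word.plaquette i j)).trace =
      (if (y, i) = l then (X * ρ (wordHolonomy e U y (Word.plaquette i j))).trace else 0) +
      (if (y + e i, j) = l then
        (X * ρ (wordHolonomy e U (y + e i) [.fwd j, .bwd i, .bwd j, .fwd i])).trace else 0) -
      (if (y + e j, i) = l then
        (X * ρ (wordHolonomy e U (y + e j) [.bwd j, .fwd i, .fwd j, .bwd i])).trace else 0) -
      (if (y, j) = l then (X * ρ (wordHolonomy e U y (Word.plaquette i j))).trace else 0) := by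
  simp only [Word.plaquette, insDeriv_cons, insDeriv_nil, stepIns, Step.link_fwd, Step.link_bwd,
    Step.isFwd_fwd, Step.isFwd_bwd, if_true, Bool.false_eq_true, if_false, Step.move_fwd, Step.move_bwd,
    add_add_sub_left, add_sub_cancel_right, wordHolonomy_cons, wordHolonomy_nil, stepHolonomy_fwd,
    stepHolonomy_bwd, mul_one, Matrix.mul_zero, add_zero, map_mul, Matrix.mul_add, Matrix.trace_add,
    map_one]
  rw [show ∀ a b c d' : ℂ, a + b - c - d' = a + (b + (-c + -d')) from fun _ _ _ _ => by ring]
  refine congrArg₂ (· + ·) ?_ (congrArg₂ (· + ·) ?_ (congrArg₂ (· + ·) ?_ ?_))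
  · split_ifs with h
    · subst h; exact trace_cyc₀ _ _ _ _ _
    · simp
  · split_ifs with h
    · subst h; exact trace_cyc₁ _ _ _ _ _
    · simp
  · split_ifs with h
    · subst h; exact trace_cyc₂ _ _ _ _ _
    · simp
  · split_ifs with h
    · subst h; exact trace_cyc₃ _ _ _ _ _
    · simp

end ActionDeriv

/-! ### Re-indexing the plaquette sum -/

section Collapse

variable {M : Type*} [AddCommMonoid M] [Fintype A]

omit [AddCommGroup A] in
/-- A sum over plaquettes as `Σ_{i<j} Σ_y`. [folklore] -/
theorem sum_plaq_eq (f : A → Fin d → Fin d → M) :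
    ∑ p : Plaq A d, f p.1 p.2.1.1 p.2.1.2 =
      ∑ i : Fin d, ∑ j : Fin d, if i < j then ∑ y : A, f y i j else 0 := by
  rw [Fintype.sum_prod_type, Finset.sum_comm]
  have h : ∑ q : DirPair d, ∑ y : A, f y q.1.1 q.1.2 =
      ∑ p ∈ (Finset.univ : Finset (Fin d × Fin d)).filter (fun p => p.1 < p.2), ∑ y : A, f y p.1 p.2 := by
    rw [← Finset.sum_subtype_eq_sum_filter, Finset.subtype_univ]
  rw [h, Finset.sum_filter, Fintype.sum_prod_type]

variable [DecidableEq A]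

omit [AddCommGroup A] in
/-- `Σ_y [y = x ∧ c] Φ(y) = [c] Φ(x)`. [folklore] -/
theorem sum_site_ite_and_eq (x : A) (c : Prop) [Decidable c] (Φ : A → M) :
    ∑ y : A, (if y = x ∧ c then Φ y else 0) = if c then Φ x else 0 := by
  by_cases hc : c
  · simp [hc, Finset.sum_ite_eq']
  · simp [hc]

/-- `Σ_y [y + e_i = x ∧ c] F(y + e_i) = [c] F(x)` (translation by `e i` is a bijection of `A`).
[folklore] -/
theorem sum_site_ite_add_and_eq (x : A) (i : Fin d) (c : Prop) [Decidable c]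
    (F : A → Fin d → Fin d → M) (a b : Fin d) :
    ∑ y : A, (if y + e i = x ∧ c then F (y + e i) a b else 0) = if c then F x a b else 0 := by
  have h := (Equiv.subRight (e i)).sum_comp
    (fun y : A => if y + e i = x ∧ c then F (y + e i) a b else 0)
  rw [← h]
  simp only [Equiv.subRight_apply, sub_add_cancel]
  exact sum_site_ite_and_eq x c (fun z => F z a b)

omit [AddCommGroup A] in
/-- [folklore] Collapse, slot 1: condition `(y, i) = (x, μ)`. -/
theorem collapse₀ (x : A) (μ : Fin d) (F : A → Fin d → Fin d → M) :
    ∑ p : Plaq A d, (if (p.1, p.2.1.1) = (x, μ) then F p.1 p.2.1.1 p.2.1.2 else 0) =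
      ∑ ν : Fin d, if μ < ν then F x μ ν else 0 := by
  rw [sum_plaq_eq (fun y i j => if (y, i) = (x, μ) then F y i j else 0)]
  simp only [Prod.mk.injEq, sum_site_ite_and_eq]
  exact sum_sum_ite_lt_eq_left μ (F x)

/-- [folklore] Collapse, slot 2: condition `(y + e_i, j) = (x, μ)`, summand through `y + e_i`. -/
theorem collapse₁ (x : A) (μ : Fin d) (F : A → Fin d → Fin d → M) :
    ∑ p : Plaq A d, (if (p.1 + e p.2.1.1, p.2.1.2) = (x, μ) then F (p.1 + e p.2.1.1) p.2.1.1 p.2.1.2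
      else 0) = ∑ ν : Fin d, if ν < μ then F x ν μ else 0 := by
  rw [sum_plaq_eq (fun y i j => if (y + e i, j) = (x, μ) then F (y + e i) i j else 0)]
  simp only [Prod.mk.injEq, sum_site_ite_add_and_eq]
  exact sum_sum_ite_lt_eq_right μ (F x)

/-- [folklore] Collapse, slot 3: condition `(y + e_j, i) = (x, μ)`, summand through `y + e_j`. -/
theorem collapse₂ (x : A) (μ : Fin d) (F : A → Fin d → Fin d → M) :
    ∑ p : Plaq A d, (if (p.1 + e p.2.1.2, p.2.1.1) = (x, μ) then F (p.1 + e p.2.1.2) p.2.1.1 p.2.1.2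
      else 0) = ∑ ν : Fin d, if μ < ν then F x μ ν else 0 := by
  rw [sum_plaq_eq (fun y i j => if (y + e j, i) = (x, μ) then F (y + e j) i j else 0)]
  simp only [Prod.mk.injEq, sum_site_ite_add_and_eq]
  exact sum_sum_ite_lt_eq_left μ (F x)

omit [AddCommGroup A] in
/-- [folklore] Collapse, slot 4: condition `(y, j) = (x, μ)`. -/
theorem collapse₃ (x : A) (μ : Fin d) (F : A → Fin d → Fin d → M) :
    ∑ p : Plaq A d, (if (p.1, p.2.1.2) = (x, μ) then F p.1 p.2.1.1 p.2.1.2 else 0) =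
      ∑ ν : Fin d, if ν < μ then F x ν μ else 0 := by
  rw [sum_plaq_eq (fun y i j => if (y, j) = (x, μ) then F y i j else 0)]
  simp only [Prod.mk.injEq, sum_site_ite_and_eq]
  exact sum_sum_ite_lt_eq_right μ (F x)

end Collapse

/-! ### Assembling: the plaquette sum in raw and in symmetric form -/

section Assembly

variable [DecidableEq A] [Fintype A]

/-- **Raw plaquette-insertion sum on a periodic lattice.** Summing the insertion derivatives of all
plaquette words for the link `l = (x, μ)`: each plaquette through `l` contributes once per slot,
re-oriented to start with `l`; planes `(μ, ν)` with `μ < ν` through the slots 1 and 3, planes with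
`ν < μ` through the slots 2 and 4. [folklore] -/
theorem sum_trace_insDeriv_plaq (U : Config A d G) (x : A) (μ : Fin d) :
    ∑ p : Plaq A d, (insDeriv ρ e (x, μ) X U p.1 (Word.plaquette p.2.1.1 p.2.1.2)).trace =
      ∑ ν : Fin d, (if μ < ν then ((X * ρ (wordHolonomy e U x (plaqWord μ ν true))).trace -
          (X * ρ (wordHolonomy e U x (plaqWord μ ν false).reverse)).trace) else 0) +
      ∑ ν : Fin d, (if ν < μ then ((X * ρ (wordHolonomy e U x (plaqWord μ ν false))).trace -
          (X * ρ (wordHolonomy e U x (plaqWord μ ν true).reverse)).trace) else 0) := by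
  simp only [trace_insDeriv_plaquette, Finset.sum_sub_distrib, Finset.sum_add_distrib]
  rw [collapse₀ x μ (fun y i j => (X * ρ (wordHolonomy e U y (Word.plaquette i j))).trace),
    collapse₁ e x μ (fun z i j => (X * ρ (wordHolonomy e U z [.fwd j, .bwd i, .bwd j, .fwd i])).trace),
    collapse₂ e x μ (fun z i j => (X * ρ (wordHolonomy e U z [.bwd j, .fwd i, .fwd j, .bwd i])).trace),
    collapse₃ x μ (fun y i j => (X * ρ (wordHolonomy e U y (Word.plaquette i j))).trace)]
  have hsplit : ∀ (c : Prop) [Decidable c] (a b : ℂ),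
      (if c then a - b else 0) = (if c then a else 0) - (if c then b else 0) := by
    intros; split_ifs <;> simp
  simp only [hsplit, Finset.sum_sub_distrib, reverse_plaqWord_true, reverse_plaqWord_false]
  simp only [plaqWord_true, plaqWord_false]
  ring

omit [DecidableEq A] [Fintype A] in
/-- For a closed word, the reversed word carries the ADJOINT matrix (unitary `ρ`). [folklore] -/
theorem rho_wordHolonomy_reverse (hρ : ∀ g, ρ g ∈ Matrix.unitaryGroup (Fin N) ℂ) (U : Config A d G)
    (x : A) (w : Word d) (hw : Word.endpoint e x w = x) :
    ρ (wordHolonomy e U x w.reverse) = (ρ (wordHolonomy e U x w))ᴴ := by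
  have h := wordHolonomy_reverse e U x w
  rw [hw] at h
  rw [h, Literature.MathematicalPhysics.QuantumLattice.unitaryRep_inv_eq_conjTranspose ρ hρ]

omit [DecidableEq A] [Fintype A] in
variable (ρ X) in
/-- The PLAQUETTE INSERTION functional at the link `(x, μ)` of the periodic lattice:
`Σ_{ν ≠ μ} Σ_{ε = ±} tr(X·(ρ(hol P̃_{ν,ε}) − ρ(hol P̃_{ν,ε}⁻¹)))`. [folklore] -/
def plaqIns (U : Config A d G) (x : A) (μ : Fin d) : ℂ :=
  ∑ ν ∈ Finset.univ.erase μ, ∑ ε : Bool,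
    (X * (ρ (wordHolonomy e U x (plaqWord μ ν ε)) - ρ (wordHolonomy e U x (plaqWord μ ν ε).reverse))).trace

/-- **The derivative of the Wilson action along the shift, symmetric form**: for skew-Hermitian `X`
and unitary `ρ`, `S'(U) = −½ · plaqIns`. [folklore] -/
theorem actionDeriv_eq_plaqIns (hX : Xᴴ = -X) (hρ : ∀ g, ρ g ∈ Matrix.unitaryGroup (Fin N) ℂ)
    (U : Config A d G) (x : A) (μ : Fin d) :
    ((actionDeriv ρ e (x, μ) X U : ℝ) : ℂ) = -(1 / 2) * plaqIns ρ e X U x μ := by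
  have hP : ∀ ν ε, ρ (wordHolonomy e U x (plaqWord μ ν ε).reverse) =
      (ρ (wordHolonomy e U x (plaqWord μ ν ε)))ᴴ :=
    fun ν ε => rho_wordHolonomy_reverse e hρ U x _ (endpoint_plaqWord e x μ ν ε)
  unfold actionDeriv plaqIns
  rw [← Complex.re_sum, sum_trace_insDeriv_plaq, Complex.ofReal_neg, Complex.add_re, Complex.ofReal_add,
    Complex.re_sum, Complex.re_sum, Complex.ofReal_sum, Complex.ofReal_sum]
  simp only [apply_ite Complex.re, Complex.zero_re, apply_ite ((↑) : ℝ → ℂ), Complex.ofReal_zero,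
    Complex.sub_re, Complex.ofReal_sub, hP, re_trace_skew_mul hX, Matrix.conjTranspose_conjTranspose,
    Matrix.mul_sub, Matrix.trace_sub, Fintype.sum_bool]
  rw [← Finset.sum_add_distrib, Finset.mul_sum, ← Finset.sum_neg_distrib]
  rw [← Finset.sum_subset (Finset.subset_univ (Finset.univ.erase μ)) (fun ν _ hν => by
    have hν' : ν = μ := by simpa using hν
    subst hν'
    simp)]
  refine Finset.sum_congr rfl fun ν hν => ?_
  have hne : ν ≠ μ := Finset.ne_of_mem_erase hν
  rcases lt_or_gt_of_ne hne with h | h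
  · simp only [h, if_true, not_lt.2 h.le, if_false]
    ring
  · simp only [h, if_true, not_lt.2 h.le, if_false]
    ring

end Assembly

/-! ### Linearity in the direction `X` -/

section Linearity

variable [DecidableEq A]

/-- `stepIns` is additive in the direction `X`. [folklore] -/
theorem stepIns_add (X₁ X₂ : Matrix (Fin N) (Fin N) ℂ) (U : Config A d G) (x : A) (s : Step d) :
    stepIns ρ e l (X₁ + X₂) U x s = stepIns ρ e l X₁ U x s + stepIns ρ e l X₂ U x s := by
  unfold stepIns
  split_ifs
  · rw [Matrix.add_mul]
  · rw [neg_add, Matrix.mul_add]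
  · rw [add_zero]

/-- `stepIns` is homogeneous in the direction `X`. [folklore] -/
theorem stepIns_smul (c : ℂ) (X : Matrix (Fin N) (Fin N) ℂ) (U : Config A d G) (x : A) (s : Step d) :
    stepIns ρ e l (c • X) U x s = c • stepIns ρ e l X U x s := by
  unfold stepIns
  split_ifs <;> simp

/-- `insDeriv` is additive in the direction `X`. [folklore] -/
theorem insDeriv_add (X₁ X₂ : Matrix (Fin N) (Fin N) ℂ) (U : Config A d G) :
    ∀ (x : A) (w : Word d),
      insDeriv ρ e l (X₁ + X₂) U x w = insDeriv ρ e l X₁ U x w + insDeriv ρ e l X₂ U x w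
  | x, [] => by simp
  | x, st :: w => by
    simp only [insDeriv_cons, stepIns_add, insDeriv_add X₁ X₂ U (st.move e x) w, Matrix.add_mul,
      Matrix.mul_add]
    abel

/-- `insDeriv` is homogeneous in the direction `X`. [folklore] -/
theorem insDeriv_smul (c : ℂ) (X : Matrix (Fin N) (Fin N) ℂ) (U : Config A d G) :
    ∀ (x : A) (w : Word d), insDeriv ρ e l (c • X) U x w = c • insDeriv ρ e l X U x w
  | x, [] => by simp
  | x, st :: w => by
    simp only [insDeriv_cons, stepIns_smul, insDeriv_smul c X U (st.move e x) w, Matrix.smul_mul,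
      Matrix.mul_smul, smul_add]

omit [DecidableEq A] in
/-- `plaqIns` is additive in `X`. [folklore] -/
theorem plaqIns_add (X₁ X₂ : Matrix (Fin N) (Fin N) ℂ) (U : Config A d G) (x : A) (μ : Fin d) :
    plaqIns ρ e (X₁ + X₂) U x μ = plaqIns ρ e X₁ U x μ + plaqIns ρ e X₂ U x μ := by
  simp only [plaqIns, Matrix.add_mul, Matrix.trace_add, Finset.sum_add_distrib]

omit [DecidableEq A] in
/-- `plaqIns` is homogeneous in `X`. [folklore] -/
theorem plaqIns_smul (c : ℂ) (X : Matrix (Fin N) (Fin N) ℂ) (U : Config A d G) (x : A) (μ : Fin d) :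
    plaqIns ρ e (c • X) U x μ = c * plaqIns ρ e X U x μ := by
  simp only [plaqIns, Matrix.smul_mul, Matrix.trace_smul, smul_eq_mul, Finset.mul_sum]

end Linearity

end TiltedRP

end Summit.QuantumFields.GaugeBoot

end
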